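import Summits.AtomisticToContinuum.HydrodynamicLimit.Theorems.LambertianContactSwapLambertianEulerTimeLedger
import Summits.AtomisticToContinuum.HydrodynamicLimit.Theorems.LambertianContactSwapSwapGapLiouvilleInvarianceLambda
import Literature.MathematicalPhysics.KineticTheory.LambertianRedrawNondegenerate
import HarnessLib

/-!
# The collision compensator of the Lambertian gas
# (crux `LambertianEuler`, stmt-AtomisticToContinuum-11854, line `Sketch`, stub `stub_collisionCompensatorLambda`)

Helper file (`--supports`) of the crux
`Summit.AtomisticToContinuum.HydrodynamicLimit.Theses.LindebergRandomFuture.LambertianEuler`, line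
`Sketch`, registered stub `stub_collisionCompensatorLambda`.

**Statement.** For the Lambertian hard-sphere flow on `𝕋³`
(`Literature.MathematicalPhysics.KineticTheory.LambertianHardSphereFlow`: states `z_m = lambertStateAfter`,
instants `t_m = lambertInstant`, count `K_b = lambertCount … b`, exit configuration
`z_m♭ = S_{τ(z_m)} z_m`, one step `z_{m+1} = lambertStep (ξs m) z_m = lambertStepMap … z_m♭ (ξs m)` off
`{τ(z_m) = ∞}`) driven by `ξs ∼ γ^ℕ = lambertNoise` with an initial law `P ≪ liouville`, a measurable
observable `F` with `|F t w| ≤ C (1 + E(w))`, `0 ≤ s ≤ b`, and `(K_b + 1)(1 + E)` integrable under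
`P ⊗ γ^ℕ`: the expected RAW collision jumps `E[∑_{m<K_b} 1_{s<t_{m+1}} (F(t_{m+1}, z_{m+1}) − F(t_{m+1}, z_m♭))]`
(produced pathwise by `stub_pathwiseProductionLambda`) equal the expected COMPENSATORS
`E[∑_{m<K_b} 1_{s<t_{m+1}} (∫ F(t_{m+1}, lambertStepMap … z_m♭ ξ) dγ(ξ) − F(t_{m+1}, z_m♭))]`.

**Proof route** (optional stopping over the collision index — the `=` version of the landed time
ledger `…LambertianEulerTimeLedgerStopping` / `…TimeLedgerFresh`).
* `tendsto_integral_sum_indicator`, `integral_sum_range_eq_of_indicator` — abstract optional stopping: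
  if a.e. `B m = {m < K}` and the terms are dominated by `D` with `D`, `K · D` integrable, windowed
  identities `∫ 1_{B m} Φ m = ∫ 1_{B m} Ψ m` sum to `∫ ∑_{m<K} Φ m = ∫ ∑_{m<K} Ψ m` (DCT).
* `integral_prod_lambertNoise_truncAt` — the `m`-th redraw is fresh given the datum and the first `m`
  redraws (Bochner form of `lintegral_prod_lambertNoise_truncAt` of `…TimeLedgerFresh`).
* `integral_indicator_jump_eq` — on `{t_{m+1} ≤ b}` (where `τ(z_m) < ∞`, `lambertStep_of_ne_top`) the
  expected jump equals the expected compensator (`lambertInstant_congr`, `lambertStateAfter_congr`).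
* `integral_sum_jump_eq_sum_compensator` — off the Zeno set `{m < K_b} = {t_{m+1} ≤ b}`
  (`…TimeLedgerStopping`), envelope `2C(1 + E)`; on `𝕋³` non-accumulation is `nonAccumulationLambda`.

**References.** C. Cercignani, R. Illner, M. Pulvirenti, *The Mathematical Theory of Dilute Gases*
(1994), App. 4.A; strong Markov property of i.i.d. redraws at a deterministic index. All `[folklore]`.
-/

noncomputable section

namespace Summit.AtomisticToContinuum.HydrodynamicLimit.Theorems.LambertianContactSwapLambertianEulerCollisionCompensator

open scoped BigOperators Topology ENNReal InnerProductSpace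
open MeasureTheory ProbabilityTheory Filter Set InformationTheory
open Literature.MathematicalPhysics.KineticTheory
open Literature.Analysis.FluidPDE Literature.Analysis.FluidPDE.Alexander
open Summit.AtomisticToContinuum.HydrodynamicLimit.Theorems.LambertianContactSwapLambertianEulerMarkov
  Summit.AtomisticToContinuum.HydrodynamicLimit.Theorems.LambertianContactSwapLambertianEulerTimeLedgerFresh
  Summit.AtomisticToContinuum.HydrodynamicLimit.Theorems.LambertianContactSwapLambertianEulerTimeLedgerStopping
  Summit.AtomisticToContinuum.HydrodynamicLimit.Theorems.LambertianContactSwapLambertianEulerMomentLedgerChain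
  Summit.AtomisticToContinuum.HydrodynamicLimit.Theorems.LambertianContactSwapSwapGapLiouvilleInvarianceLambda

/-! ## Abstract optional stopping over a random index -/

section Stopping

variable {α : Type*} [MeasurableSpace α] {μ : Measure α}

/-- **Dominated convergence of windowed partial sums**: if a.e. `B m = {m < K}` and `|Φ m| ≤ D` with
`K · D ≤ bound` integrable, then `∫ ∑_{m<n} 1_{B m} Φ m → ∫ ∑_{m<K} Φ m`. [folklore] -/
theorem tendsto_integral_sum_indicator {K : α → ℕ} {B : ℕ → Set α}
    (hB : ∀ m, MeasurableSet (B m)) {Φ : ℕ → α → ℝ} (hΦm : ∀ m, Measurable (Φ m))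
    {D bound : α → ℝ} (hD : ∀ m p, |Φ m p| ≤ D p) (hbound : Integrable bound μ)
    (hle : ∀ p, (K p : ℝ) * D p ≤ bound p)
    (hKB : ∀ᵐ p ∂μ, (∀ m, K p ≤ m → p ∉ B m) ∧ (∀ m, m < K p → p ∈ B m)) :
    Tendsto (fun n => ∫ p, (∑ m ∈ Finset.range n, (B m).indicator (Φ m) p) ∂μ) atTop
      (𝓝 (∫ p, (∑ m ∈ Finset.range (K p), Φ m p) ∂μ)) := by
  refine tendsto_integral_of_dominated_convergence bound
    (fun n => (Finset.measurable_sum _ fun m _ => (hΦm m).indicator (hB m)).aestronglyMeasurable)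
    hbound (fun n => ?_) ?_
  · filter_upwards [hKB] with p hp
    rw [Real.norm_eq_abs]
    refine (abs_sum_range_le_of_eq_zero (K := K p) (B := D p) (fun m => ?_)
      (fun m hm => Set.indicator_of_notMem (hp.1 m hm) _) n).trans (hle p)
    calc |(B m).indicator (Φ m) p| ≤ |Φ m p| := by
          simpa only [Real.norm_eq_abs] using norm_indicator_le_norm_self (Φ m) p
      _ ≤ D p := hD m p
  · filter_upwards [hKB] with p hp
    refine tendsto_atTop_of_eventually_const (i₀ := K p) fun n hn => ?_
    rw [Finset.eventually_constant_sum (fun m hm => Set.indicator_of_notMem (hp.1 m hm) _) hn]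
    exact Finset.sum_congr rfl fun m hm => Set.indicator_of_mem (hp.2 m (Finset.mem_range.1 hm)) _

/-- **Abstract optional stopping over a random index**: if a.e. `B m = {m < K}`, the measurable
terms `Φ m`, `Ψ m` are bounded by an integrable `D` with `K · D ≤ bound` integrable, and
`∫ 1_{B m} Φ m = ∫ 1_{B m} Ψ m` for every `m`, then `∫ ∑_{m<K} Φ m = ∫ ∑_{m<K} Ψ m`. [folklore] -/
theorem integral_sum_range_eq_of_indicator {K : α → ℕ} {B : ℕ → Set α}
    (hB : ∀ m, MeasurableSet (B m)) {Φ Ψ : ℕ → α → ℝ} (hΦm : ∀ m, Measurable (Φ m))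
    (hΨm : ∀ m, Measurable (Ψ m)) {D bound : α → ℝ} (hΦD : ∀ m p, |Φ m p| ≤ D p)
    (hΨD : ∀ m p, |Ψ m p| ≤ D p) (hDint : Integrable D μ) (hbound : Integrable bound μ)
    (hle : ∀ p, (K p : ℝ) * D p ≤ bound p)
    (hKB : ∀ᵐ p ∂μ, (∀ m, K p ≤ m → p ∉ B m) ∧ (∀ m, m < K p → p ∈ B m))
    (hstep : ∀ m, ∫ p, (B m).indicator (Φ m) p ∂μ = ∫ p, (B m).indicator (Ψ m) p ∂μ) :
    ∫ p, (∑ m ∈ Finset.range (K p), Φ m p) ∂μ = ∫ p, (∑ m ∈ Finset.range (K p), Ψ m p) ∂μ := by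
  have hint : ∀ {Θ : ℕ → α → ℝ}, (∀ m, Measurable (Θ m)) → (∀ m p, |Θ m p| ≤ D p) →
      ∀ m, Integrable ((B m).indicator (Θ m)) μ := fun hΘm hΘD m =>
    (hDint.mono' (hΘm m).aestronglyMeasurable (Eventually.of_forall fun p =>
      (Real.norm_eq_abs _).trans_le (hΘD m p))).indicator (hB m)
  have hsum : ∀ n, ∫ p, (∑ m ∈ Finset.range n, (B m).indicator (Φ m) p) ∂μ =
      ∫ p, (∑ m ∈ Finset.range n, (B m).indicator (Ψ m) p) ∂μ := fun n => by
    rw [integral_finsetSum _ fun m _ => hint hΦm hΦD m, integral_finsetSum _ fun m _ => hint hΨm hΨD m]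
    exact Finset.sum_congr rfl fun m _ => hstep m
  exact tendsto_nhds_unique (tendsto_integral_sum_indicator hB hΦm hΦD hbound hle hKB)
    ((tendsto_integral_sum_indicator hB hΨm hΨD hbound hle hKB).congr fun n => (hsum n).symm)

/-- `|1_q (a - c)| ≤ 2e` whenever `|a|, |c| ≤ e`. [folklore] -/
theorem abs_ite_sub_le {q : Prop} [Decidable q] {a c e : ℝ} (ha : |a| ≤ e) (hc : |c| ≤ e) :
    |(if q then a - c else 0)| ≤ 2 * e := by
  split_ifs
  · exact (abs_sub a c).trans (by linarith)
  · rw [abs_zero]; linarith [abs_nonneg a]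

end Stopping

/-! ## The Lambertian recursion on `𝕋³`: a fresh redraw, the windowed identity, optional stopping -/

section Compensator

variable {N : ℕ} {G : Geometry (Fin 3) T3} {ε : ℝ}

/-- **The `n`-th redraw is fresh given the datum and the redraws below `n`** (Bochner form under
`P ⊗ γ^ℕ`): `(z, ξs) ↦ ((z, ξs|<n), ξs n)` pushes `P ⊗ γ^ℕ` forward to `law(z, ξs|<n) ⊗ γ` (Tonelli
form `lintegral_prod_lambertNoise_truncAt` and `Measure.ext_of_lintegral`), whence for a measurable
real `Φ` integrable along that map `∫ Φ((z, ξs|<n), ξs n) = ∫ (∫ Φ((z, ξs|<n), ξ) dγ(ξ))`. [folklore] -/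
theorem integral_prod_lambertNoise_truncAt (P : Measure (Config N (Fin 3) T3)) [SFinite P] (n : ℕ)
    {Φ : (Config N (Fin 3) T3 × (ℕ → V3)) × V3 → ℝ} (hΦ : Measurable Φ) (hint : Integrable (fun p =>
      Φ ((p.1, fun i => if i < n then p.2 i else 0), p.2 n)) (P.prod (lambertNoise (Fin 3)))) :
    ∫ p, Φ ((p.1, fun i => if i < n then p.2 i else 0), p.2 n) ∂(P.prod (lambertNoise (Fin 3))) =
      ∫ p, (∫ ξ, Φ ((p.1, fun i => if i < n then p.2 i else 0), ξ) ∂(stdGaussian V3))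
        ∂(P.prod (lambertNoise (Fin 3))) := by
  have hS : Measurable fun p : Config N (Fin 3) T3 × (ℕ → V3) =>
      ((p.1, fun i => if i < n then p.2 i else 0) : Config N (Fin 3) T3 × (ℕ → V3)) :=
    measurable_fst.prodMk ((measurable_truncAt (Fin 3) n).comp measurable_snd)
  have hT : Measurable fun p : Config N (Fin 3) T3 × (ℕ → V3) =>
      (((p.1, fun i => if i < n then p.2 i else 0) : Config N (Fin 3) T3 × (ℕ → V3)), p.2 n) :=
    hS.prodMk ((measurable_pi_apply n).comp measurable_snd)
  have hmap : (P.prod (lambertNoise (Fin 3))).map (fun p =>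
      (((p.1, fun i => if i < n then p.2 i else 0) : Config N (Fin 3) T3 × (ℕ → V3)), p.2 n)) =
      ((P.prod (lambertNoise (Fin 3))).map fun p => ((p.1, fun i => if i < n then p.2 i else 0) :
        Config N (Fin 3) T3 × (ℕ → V3))).prod (stdGaussian V3) := by
    refine Measure.ext_of_lintegral _ fun f hf => ?_
    rw [lintegral_map hf hT, lintegral_prod _ hf.aemeasurable, lintegral_map hf.lintegral_prod_right' hS]
    exact lintegral_prod_lambertNoise_truncAt P n hf
  have hintT := (integrable_map_measure hΦ.aestronglyMeasurable hT.aemeasurable).2 hint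
  rw [← integral_map hT.aemeasurable hΦ.aestronglyMeasurable, hmap, integral_prod _ (hmap ▸ hintT)]
  exact integral_map hS.aemeasurable (hΦ.stronglyMeasurable.integral_prod_right').aestronglyMeasurable

/-- The cosine redraw of an incoming pair (if any) never increases the kinetic energy. [folklore] -/
theorem configEnergy_lambertStepMap_le (w : Config N (Fin 3) T3) (ξ : V3) :
    configEnergy (lambertStepMap G (incomingPairs G ε w) w ξ) ≤ configEnergy w := by
  unfold lambertStepMap
  split_ifs with hne
  · exact configEnergy_lambertPair_le (ne_of_lt (mem_incomingPairs.1 hne.some_mem).1) _ ξ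
  · exact le_rfl

/-- **The expected jump at the `m`-th collision equals its compensator, on `{t_{m+1} ≤ b}`**
(regular measurable geometry, measurable `F` with `|F t w| ≤ C (1 + E(w))`, `C ≥ 0`; abbreviations
`T1 = t_{m+1}` (real), `Zp = z_m♭`, `Zs = z_{m+1}`). On the event `τ(z_m) < ∞`, so
`Zs = lambertStepMap … Zp (ξs m)` (`lambertStep_of_ne_top`); the event, `T1`, `Zp` are functions of
the datum and the first `m` redraws, and the `m`-th redraw is fresh. [folklore] -/
theorem integral_indicator_jump_eq (hG : G.IsHardSphereRegular ε) (hGm : G.IsMeasurable)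
    {F : ℝ → Config N (Fin 3) T3 → ℝ} (hFm : Measurable (Function.uncurry F)) {C : ℝ} (hC0 : 0 ≤ C)
    (hFC : ∀ t w, |F t w| ≤ C * (1 + configEnergy w)) (P : Measure (Config N (Fin 3) T3)) [SFinite P]
    (m : ℕ) (s b : ℝ) {B : Set (Config N (Fin 3) T3 × (ℕ → V3))}
    (hBdef : B = {p | lambertInstant G ε p.2 p.1 (m + 1) ≤ ENNReal.ofReal b})
    {T1 : Config N (Fin 3) T3 × (ℕ → V3) → ℝ} {Zp Zs : Config N (Fin 3) T3 × (ℕ → V3) → Config N (Fin 3) T3}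
    (hTm : Measurable T1) (hZpm : Measurable Zp)
    (hT1 : ∀ p, T1 p = (lambertInstant G ε p.2 p.1 (m + 1)).toReal)
    (hZp : ∀ p, Zp p = freeFlight G
      (freeExitTime G ε (lambertStateAfter G ε p.2 p.1 m)).toReal (lambertStateAfter G ε p.2 p.1 m))
    (hZs : ∀ p, Zs p = lambertStateAfter G ε p.2 p.1 (m + 1))
    (hint : Integrable (B.indicator fun p => if s < T1 p then F (T1 p) (Zs p) - F (T1 p) (Zp p) else 0)
      (P.prod (lambertNoise (Fin 3)))) :
    ∫ p, B.indicator (fun p => if s < T1 p then F (T1 p) (Zs p) - F (T1 p) (Zp p) else 0) p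
        ∂(P.prod (lambertNoise (Fin 3))) =
      ∫ p, B.indicator (fun p => if s < T1 p then (∫ ξ, F (T1 p) (lambertStepMap G
        (incomingPairs G ε (Zp p)) (Zp p) ξ) ∂(stdGaussian V3)) - F (T1 p) (Zp p) else 0) p
        ∂(P.prod (lambertNoise (Fin 3))) := by
  classical
  have hB : MeasurableSet B := hBdef ▸ measurableSet_le (measurable_lambertInstant hG hGm (m + 1)) measurable_const
  set H : (Config N (Fin 3) T3 × (ℕ → V3)) × V3 → ℝ := fun r => if r.1 ∈ B then (if s < T1 r.1 then
    F (T1 r.1) (lambertStepMap G (incomingPairs G ε (Zp r.1)) (Zp r.1) r.2) - F (T1 r.1) (Zp r.1)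
    else 0) else 0 with hHdef
  have hHm : Measurable H := by
    refine Measurable.ite (measurable_fst hB) (Measurable.ite
      (measurableSet_lt measurable_const (hTm.comp measurable_fst)) ?_ measurable_const) measurable_const
    exact (hFm.comp ((hTm.comp measurable_fst).prodMk (measurable_lambertStepMap_incomingPairs hGm
      (hZpm.comp measurable_fst) measurable_snd))).sub
      (hFm.comp ((hTm.comp measurable_fst).prodMk (hZpm.comp measurable_fst)))
  -- locality: `H` only depends on the datum and the first `m` redraws
  have hloc : ∀ (p : Config N (Fin 3) T3 × (ℕ → V3)) (ξ : V3),
      H ((p.1, fun i => if i < m then p.2 i else 0), ξ) = H (p, ξ) := by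
    intro p ξ
    have hI : lambertInstant G ε (fun i => if i < m then p.2 i else 0) p.1 (m + 1) =
        lambertInstant G ε p.2 p.1 (m + 1) := lambertInstant_congr (fun i hi => if_pos hi) le_rfl
    have hS : lambertStateAfter G ε (fun i => if i < m then p.2 i else 0) p.1 m =
        lambertStateAfter G ε p.2 p.1 m := lambertStateAfter_congr (fun i hi => if_pos hi) le_rfl
    simp only [hHdef, hBdef, Set.mem_setOf_eq, hT1, hZp, hI, hS]
  -- on the event, the jump integrand is `H` read at the `m`-th redraw
  have hL : ∀ p, B.indicator (fun p => if s < T1 p then F (T1 p) (Zs p) - F (T1 p) (Zp p) else 0) p =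
      H (p, p.2 m) := by
    intro p
    by_cases hpB : p ∈ B
    · have hτ : freeExitTime G ε (lambertStateAfter G ε p.2 p.1 m) ≠ ∞ := fun htop => by
        have h' := hBdef ▸ hpB
        rw [Set.mem_setOf_eq, lambertInstant_succ, htop, add_top, top_le_iff] at h'
        exact ENNReal.ofReal_ne_top h'
      have hs' : Zs p = lambertStepMap G (incomingPairs G ε (Zp p)) (Zp p) (p.2 m) := by
        rw [hZs, lambertStateAfter_succ, lambertStep_of_ne_top hτ, hZp]
      simp only [Set.indicator_of_mem hpB, hHdef, if_pos hpB, hs']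
    · simp only [Set.indicator_of_notMem hpB, hHdef, if_neg hpB]
  -- the Gaussian average of `H` is the compensator integrand
  have hR : ∀ p, (∫ ξ, H (p, ξ) ∂(stdGaussian V3)) = B.indicator (fun p =>
      if s < T1 p then (∫ ξ, F (T1 p) (lambertStepMap G (incomingPairs G ε (Zp p)) (Zp p) ξ)
        ∂(stdGaussian V3)) - F (T1 p) (Zp p) else 0) p := by
    intro p
    by_cases hpB : p ∈ B
    · by_cases hsT : s < T1 p
      · have hi : Integrable (fun ξ => F (T1 p) (lambertStepMap G (incomingPairs G ε (Zp p)) (Zp p) ξ))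
            (stdGaussian V3) := by
          refine (integrable_const (C * (1 + configEnergy (Zp p)))).mono'
            (hFm.comp (measurable_const.prodMk (measurable_lambertStepMap_incomingPairs
              hGm measurable_const measurable_id))).aestronglyMeasurable (Eventually.of_forall fun ξ => ?_)
          rw [Real.norm_eq_abs]
          exact (hFC _ _).trans (mul_le_mul_of_nonneg_left
            (add_le_add le_rfl (configEnergy_lambertStepMap_le _ _)) hC0)
        simp only [hHdef, if_pos hpB, if_pos hsT, Set.indicator_of_mem hpB]
        rw [integral_sub hi (integrable_const _), integral_const, probReal_univ, one_smul]
      · simp only [hHdef, if_pos hpB, if_neg hsT, Set.indicator_of_mem hpB, integral_zero]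
    · simp only [hHdef, if_neg hpB, Set.indicator_of_notMem hpB, integral_zero]
  -- the `m`-th redraw is fresh
  have e1 : (B.indicator fun p => if s < T1 p then F (T1 p) (Zs p) - F (T1 p) (Zp p) else 0) =
      fun p => H ((p.1, fun i => if i < m then p.2 i else 0), p.2 m) :=
    funext fun p => by rw [hloc]; exact hL p
  have e2 : (B.indicator fun p => if s < T1 p then (∫ ξ, F (T1 p) (lambertStepMap G
        (incomingPairs G ε (Zp p)) (Zp p) ξ) ∂(stdGaussian V3)) - F (T1 p) (Zp p) else 0) =
      fun p => ∫ ξ, H ((p.1, fun i => if i < m then p.2 i else 0), ξ) ∂(stdGaussian V3) :=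
    funext fun p => by simp only [hloc]; exact (hR p).symm
  have h := integral_prod_lambertNoise_truncAt P m hHm (by rw [← e1]; exact hint)
  rw [← e1, ← e2] at h
  exact h

/-- **The expected raw collision jumps equal the expected compensators** (regular measurable
geometry on `𝕋³`, s-finite initial law): for measurable `F` with `|F t w| ≤ C (1 + E(w))`, `C ≥ 0`,
times `s`, `b`, abbreviations `T1 m = t_{m+1}` (real), `Zp m = z_m♭`, `Zs m = z_{m+1}`, if
`(K_b + 1)(1 + E)` is integrable and the instants a.e. pass beyond `b` under `P ⊗ γ^ℕ`, then
`E[∑_{m<K_b} 1_{s<T1 m} (F(T1 m, Zs m) − F(T1 m, Zp m))]` equals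
`E[∑_{m<K_b} 1_{s<T1 m} (∫ F(T1 m, lambertStepMap … (Zp m) ξ) dγ(ξ) − F(T1 m, Zp m))]`: optional
stopping `integral_sum_range_eq_of_indicator` over `{t_{m+1} ≤ b} = {m < K_b}` (off the Zeno set) of
the windowed identities `integral_indicator_jump_eq`, envelope `2C(1 + E)`. [folklore] -/
theorem integral_sum_jump_eq_sum_compensator (hG : G.IsHardSphereRegular ε) (hGm : G.IsMeasurable)
    {F : ℝ → Config N (Fin 3) T3 → ℝ} (hFm : Measurable (Function.uncurry F)) {C : ℝ} (hC0 : 0 ≤ C)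
    (hFC : ∀ t w, |F t w| ≤ C * (1 + configEnergy w)) (P : Measure (Config N (Fin 3) T3)) [SFinite P]
    (s b : ℝ) {T1 : ℕ → Config N (Fin 3) T3 × (ℕ → V3) → ℝ}
    {Zp Zs : ℕ → Config N (Fin 3) T3 × (ℕ → V3) → Config N (Fin 3) T3}
    (hT1 : ∀ m p, T1 m p = (lambertInstant G ε p.2 p.1 (m + 1)).toReal)
    (hZp : ∀ m p, Zp m p = freeFlight G
      (freeExitTime G ε (lambertStateAfter G ε p.2 p.1 m)).toReal (lambertStateAfter G ε p.2 p.1 m))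
    (hZs : ∀ m p, Zs m p = lambertStateAfter G ε p.2 p.1 (m + 1))
    (hInt : Integrable (fun p => ((lambertCount G ε p.2 p.1 b : ℝ) + 1) * (1 + configEnergy p.1))
      (P.prod (lambertNoise (Fin 3))))
    (hacc : ∀ᵐ p ∂(P.prod (lambertNoise (Fin 3))), ∃ n, ENNReal.ofReal b < lambertInstant G ε p.2 p.1 n) :
    ∫ p, (∑ m ∈ Finset.range (lambertCount G ε p.2 p.1 b),
        if s < T1 m p then F (T1 m p) (Zs m p) - F (T1 m p) (Zp m p) else 0) ∂(P.prod (lambertNoise (Fin 3))) =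
      ∫ p, (∑ m ∈ Finset.range (lambertCount G ε p.2 p.1 b),
        if s < T1 m p then (∫ ξ, F (T1 m p) (lambertStepMap G (incomingPairs G ε (Zp m p)) (Zp m p) ξ)
          ∂(stdGaussian V3)) - F (T1 m p) (Zp m p) else 0) ∂(P.prod (lambertNoise (Fin 3))) := by
  have hZm : ∀ m, Measurable fun p : Config N (Fin 3) T3 × (ℕ → V3) => lambertStateAfter G ε p.2 p.1 m :=
    fun m => measurable_lambertStateAfter hG hGm m
  have hTm : ∀ m, Measurable (T1 m) := fun m =>
    funext (hT1 m) ▸ (measurable_lambertInstant hG hGm (m + 1)).ennreal_toReal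
  have hZpm : ∀ m, Measurable (Zp m) := fun m => funext (hZp m) ▸ hGm.measurable_freeFlight₂.comp
    ((((measurable_freeExitTime hG hGm).comp (hZm m)).ennreal_toReal).prodMk (hZm m))
  have hZsm : ∀ m, Measurable (Zs m) := fun m => funext (hZs m) ▸ hZm (m + 1)
  set B : ℕ → Set (Config N (Fin 3) T3 × (ℕ → V3)) := fun m =>
    {p | lambertInstant G ε p.2 p.1 (m + 1) ≤ ENNReal.ofReal b} with hBdef
  have hB : ∀ m, MeasurableSet (B m) := fun m =>
    measurableSet_le (measurable_lambertInstant hG hGm (m + 1)) measurable_const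
  have hΦm : ∀ m, Measurable fun p =>
      if s < T1 m p then F (T1 m p) (Zs m p) - F (T1 m p) (Zp m p) else 0 := fun m =>
    Measurable.ite (measurableSet_lt measurable_const (hTm m))
      ((hFm.comp ((hTm m).prodMk (hZsm m))).sub (hFm.comp ((hTm m).prodMk (hZpm m)))) measurable_const
  have hIm : ∀ m, Measurable fun p =>
      ∫ ξ, F (T1 m p) (lambertStepMap G (incomingPairs G ε (Zp m p)) (Zp m p) ξ) ∂(stdGaussian V3) :=
    fun m => ((hFm.comp (((hTm m).comp measurable_fst).prodMk (measurable_lambertStepMap_incomingPairs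
      hGm ((hZpm m).comp measurable_fst) measurable_snd))).stronglyMeasurable.integral_prod_right'
      (ν := stdGaussian V3)).measurable
  have hΨm : ∀ m, Measurable fun p => if s < T1 m p then (∫ ξ, F (T1 m p) (lambertStepMap G
      (incomingPairs G ε (Zp m p)) (Zp m p) ξ) ∂(stdGaussian V3)) - F (T1 m p) (Zp m p) else 0 :=
    fun m => Measurable.ite (measurableSet_lt measurable_const (hTm m))
      ((hIm m).sub (hFm.comp ((hTm m).prodMk (hZpm m)))) measurable_const
  -- the envelope `2 C (1 + E)` of the terms (the kinetic energy never increases)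
  have hE0 : ∀ w : Config N (Fin 3) T3, 0 ≤ 1 + configEnergy w := fun w =>
    add_nonneg zero_le_one (configEnergy_nonneg w)
  have hFE : ∀ (t : ℝ) {w : Config N (Fin 3) T3} {e : ℝ}, configEnergy w ≤ e → |F t w| ≤ C * (1 + e) :=
    fun t w e hw => (hFC t w).trans (mul_le_mul_of_nonneg_left (add_le_add le_rfl hw) hC0)
  have hEZp : ∀ m p, configEnergy (Zp m p) ≤ configEnergy p.1 := fun m p => by
    rw [hZp, configEnergy_freeFlight]
    exact configEnergy_lambertStateAfter_le _ _ _
  have hΦD : ∀ m p, |(if s < T1 m p then F (T1 m p) (Zs m p) - F (T1 m p) (Zp m p) else 0)| ≤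
      2 * (C * (1 + configEnergy p.1)) := fun m p =>
    abs_ite_sub_le (hFE _ (by rw [hZs]; exact configEnergy_lambertStateAfter_le _ _ _)) (hFE _ (hEZp m p))
  have hΨD : ∀ m p, |(if s < T1 m p then (∫ ξ, F (T1 m p) (lambertStepMap G (incomingPairs G ε (Zp m p))
      (Zp m p) ξ) ∂(stdGaussian V3)) - F (T1 m p) (Zp m p) else 0)| ≤ 2 * (C * (1 + configEnergy p.1)) := by
    intro m p
    refine abs_ite_sub_le ?_ (hFE _ (hEZp m p))
    have h := norm_integral_le_of_norm_le_const (μ := stdGaussian V3)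
      (f := fun ξ => F (T1 m p) (lambertStepMap G (incomingPairs G ε (Zp m p)) (Zp m p) ξ))
      (C := C * (1 + configEnergy p.1)) (Eventually.of_forall fun ξ => ?_)
    · rwa [probReal_univ, mul_one, Real.norm_eq_abs] at h
    · rw [Real.norm_eq_abs]
      exact hFE _ ((configEnergy_lambertStepMap_le _ _).trans (hEZp m p))
  -- integrability of the envelope; the dominating function `2 C (K_b + 1)(1 + E)`
  have hEm : Measurable fun p : Config N (Fin 3) T3 × (ℕ → V3) => 2 * (C * (1 + configEnergy p.1)) := by
    unfold configEnergy
    exact measurable_const.mul (measurable_const.mul (measurable_const.add (measurable_const.mul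
      (Finset.measurable_sum _ fun i _ =>
        (((measurable_pi_apply i).comp measurable_fst).snd.norm).pow_const 2))))
  have hDint : Integrable (fun p => 2 * (C * (1 + configEnergy p.1))) (P.prod (lambertNoise (Fin 3))) :=
    (hInt.const_mul (2 * C)).mono' hEm.aestronglyMeasurable (Eventually.of_forall fun p => by
      rw [Real.norm_of_nonneg (mul_nonneg zero_le_two (mul_nonneg hC0 (hE0 p.1)))]
      have h1 : C * (1 + configEnergy p.1) ≤
          C * (((lambertCount G ε p.2 p.1 b : ℝ) + 1) * (1 + configEnergy p.1)) :=
        mul_le_mul_of_nonneg_left (le_mul_of_one_le_left (hE0 p.1)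
          (le_add_of_nonneg_left (Nat.cast_nonneg _))) hC0
      nlinarith [h1])
  have hle : ∀ (k : ℝ) {e : ℝ}, 0 ≤ 1 + e → k * (2 * (C * (1 + e))) ≤ 2 * C * ((k + 1) * (1 + e)) :=
    fun k e he => by nlinarith [mul_nonneg hC0 he]
  -- off the Zeno set, `{t_{m+1} ≤ b} = {m < K_b}`
  have hKB : ∀ᵐ p ∂(P.prod (lambertNoise (Fin 3))), (∀ m, lambertCount G ε p.2 p.1 b ≤ m → p ∉ B m) ∧
      (∀ m, m < lambertCount G ε p.2 p.1 b → p ∈ B m) := by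
    filter_upwards [hacc] with p hp
    exact ⟨fun m hm hpB => (not_le.2 (lt_lambertCount_of_instant_succ_le hp hpB)) hm,
      fun m hm => instant_succ_le_of_lt_lambertCount hp hm⟩
  -- optional stopping
  refine integral_sum_range_eq_of_indicator (K := fun p : Config N (Fin 3) T3 × (ℕ → V3) =>
      lambertCount G ε p.2 p.1 b) hB hΦm hΨm hΦD hΨD hDint (hInt.const_mul (2 * C))
    (fun p => hle _ (hE0 p.1)) hKB fun m => ?_
  exact integral_indicator_jump_eq hG hGm hFm hC0 hFC P m s b rfl (hTm m) (hZpm m) (hT1 m) (hZp m)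
    (hZs m) ((hDint.mono' (hΦm m).aestronglyMeasurable (Eventually.of_forall fun p =>
      (Real.norm_eq_abs _).trans_le (hΦD m p))).indicator (hB m))

end Compensator

/-- **The collision compensator of the Lambertian gas on `𝕋³`** (registered stub
`stub_collisionCompensatorLambda`, line `Sketch` of the crux `LambertianEuler`): for `0 < σ < 1/2`,
`N + 1` spheres of diameter `hsDiameter σ N`, a measurable observable `F` of at most energy growth, a
finite initial law `P ≪ liouville`, times `0 ≤ s ≤ b`, and `(K_b + 1)(1 + E)` integrable under
`P ⊗ γ^ℕ`, the expected raw collision jumps of `F` over the counted collisions after `s` equal the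
expected compensators (`integral_sum_jump_eq_sum_compensator` on the torus geometry, regular and
measurable for `hsDiameter σ N < 1/2`; the a.e. non-accumulation `nonAccumulationLambda` transported
along `P ⊗ γ^ℕ ≪ liouville ⊗ γ^ℕ`). [folklore] -/
theorem stub_collisionCompensatorLambda :
    ∀ {σ : ℝ}, 0 < σ → σ < 2⁻¹ → ∀ (N : ℕ) (F : ℝ → Config (N + 1) (Fin 3) T3 → ℝ),
      Measurable (Function.uncurry F) →
      (∃ C : ℝ, ∀ (t : ℝ) (w : Config (N + 1) (Fin 3) T3), |F t w| ≤ C * (1 + configEnergy w)) →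
      ∀ (P : Measure (Config (N + 1) (Fin 3) T3)) [IsFiniteMeasure P],
        P ≪ liouville (Torus.geometry (Fin 3)) (N + 1) (hsDiameter σ N) →
        ∀ (s b : ℝ), 0 ≤ s → s ≤ b →
          Integrable (fun q : Config (N + 1) (Fin 3) T3 × (ℕ → V3) =>
            ((lambertCount (Torus.geometry (Fin 3)) (hsDiameter σ N) q.2 q.1 b : ℝ) + 1) *
              (1 + configEnergy q.1)) (P.prod (lambertNoise (Fin 3))) →
          (let tc := fun (q : Config (N + 1) (Fin 3) T3 × (ℕ → V3)) (m : ℕ) =>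
             (lambertInstant (Torus.geometry (Fin 3)) (hsDiameter σ N) q.2 q.1 (m + 1)).toReal
           let zpre := fun (q : Config (N + 1) (Fin 3) T3 × (ℕ → V3)) (m : ℕ) =>
             freeFlight (Torus.geometry (Fin 3))
               (freeExitTime (Torus.geometry (Fin 3)) (hsDiameter σ N)
                 (lambertStateAfter (Torus.geometry (Fin 3)) (hsDiameter σ N) q.2 q.1 m)).toReal
               (lambertStateAfter (Torus.geometry (Fin 3)) (hsDiameter σ N) q.2 q.1 m)
           let zpost := fun (q : Config (N + 1) (Fin 3) T3 × (ℕ → V3)) (m : ℕ) =>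
             lambertStateAfter (Torus.geometry (Fin 3)) (hsDiameter σ N) q.2 q.1 (m + 1)
           ∫ q, (∑ m ∈ Finset.range (lambertCount (Torus.geometry (Fin 3)) (hsDiameter σ N) q.2 q.1 b),
               if s < tc q m then F (tc q m) (zpost q m) - F (tc q m) (zpre q m) else 0)
             ∂(P.prod (lambertNoise (Fin 3))) =
           ∫ q, (∑ m ∈ Finset.range (lambertCount (Torus.geometry (Fin 3)) (hsDiameter σ N) q.2 q.1 b),
               if s < tc q m then
                 (∫ ξ, F (tc q m) (lambertStepMap (Torus.geometry (Fin 3))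
                     (incomingPairs (Torus.geometry (Fin 3)) (hsDiameter σ N) (zpre q m)) (zpre q m) ξ)
                   ∂(stdGaussian V3)) - F (tc q m) (zpre q m)
               else 0)
             ∂(P.prod (lambertNoise (Fin 3)))) := by
  intro σ hσ hσ' N F hFm hC P _ hP s b _hs _hsb hInt
  obtain ⟨C, hC⟩ := hC
  have hε' : hsDiameter σ N < 2⁻¹ := (hsDiameter_le hσ.le N).trans_lt hσ'
  have hC' : ∀ (t : ℝ) (w : Config (N + 1) (Fin 3) T3), |F t w| ≤ max C 0 * (1 + configEnergy w) :=
    fun t w => (hC t w).trans (mul_le_mul_of_nonneg_right (le_max_left _ _)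
      (add_nonneg zero_le_one (configEnergy_nonneg w)))
  have hacc : ∀ᵐ p ∂(P.prod (lambertNoise (Fin 3))),
      ∃ n, ENNReal.ofReal b < lambertInstant (Torus.geometry (Fin 3)) (hsDiameter σ N) p.2 p.1 n := by
    filter_upwards [(hP.prod Measure.AbsolutelyContinuous.rfl).ae_le
      (nonAccumulationLambda _ (hsDiameter_pos hσ N) hε' (N + 1))] with p hp
    exact hp b
  exact integral_sum_jump_eq_sum_compensator (Torus.isHardSphereRegular_geometry hε')
    Torus.isMeasurable_geometry hFm (le_max_right _ _) hC' P s b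
    (fun _ _ => rfl) (fun _ _ => rfl) (fun _ _ => rfl) hInt hacc

end Summit.AtomisticToContinuum.HydrodynamicLimit.Theorems.LambertianContactSwapLambertianEulerCollisionCompensator

end
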